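import Summits.Ventures.PercRepro.S1CFCapsLineThree
import Summits.Ventures.PercRepro.S1CFGLine

/-!
# PercRepro — `Q₄²` ON ANY `n ≥ 11` POINTS: `Q₄² ≤ max (n + 29) (4n − 15)`, `Q₄² ≤ 4(n − 4) + 1` WITH FIVE DEPENDENT
PAIRS, `Q₃¹ ≤ 1` WITH AT MOST FIVE (p1, gen 38)

The assembly of the cap `Q₄²` of p7's ν = 4 program for every ground set of `n ≥ 11` points (the `12`-point theorems of
S1CFCapsLineTwo / S1CFCapsLineThree, p1 gen 37). **`ncard_three_eRk_le_one_le_one_of_le_five`** (`n ≥ 9`): with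
`D₂ ≤ 5` the rank-`1` triples all lie in one class, of `≤ 3` points: `Q₃¹ ≤ 1`.
**`ncard_four_eRk_le_two_through_pair_eq_zero_of_four_le`** (`n ≥ 11`): with `≥ 4` dependent pairs the third class of the
split is empty (it would give a triangle — LEMMA K). **`ncard_four_eRk_le_two_le_of_five_le`** (`n ≥ 11`): with `D₂ ≥ 5`
every `4`-set of rank `≤ 2` meets the class `F` of `4` in `≥ 3` points: `Q₄² ≤ C(4, 3) · (n − 4) + 1`.
**`ncard_four_eRk_le_two_le`** (`n ≥ 11`): `Q₄² ≤ max (n + 29) (4 · n − 15)` — `D₂ ≤ 3`: `5 + (n − 3) + 9 + 18`; `D₂ = 4`: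
`5 + (n − 3) + 16`; `D₂ ≥ 5`: `4(n − 4) + 1` (the second term wins from `n = 15` on; at `n = 12` the landed `41`).
Nothing about any cell is claimed. Axioms: standard.
-/

open scoped Matroid

namespace PercRepro

namespace S1CFG

open Set S1CF

variable {α : Type}

/-- **`D₂ ≤ 5 ⇒ Q₃¹ ≤ 1`** (`n ≥ 9`): the rank-`1` triples lie in one class of at most `3` points. -/
theorem ncard_three_eRk_le_one_le_one_of_le_five (M : Matroid α) [M.Finite] (hL : ∀ e ∈ M.E, ¬ M.IsLoop e)
    (hK : ∀ e, ¬ M.IsColoop e) (hd : M.E.encard = M.eRank + ((4 : ℕ) : ℕ∞)) (hn : 9 ≤ M.E.ncard)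
    (h5 : {P : Set α | P ⊆ M.E ∧ P.ncard = 2 ∧ M.Dep P}.ncard ≤ 5) :
    {X : Set α | X ⊆ M.E ∧ X.ncard = 3 ∧ M.eRk X ≤ 1}.ncard ≤ 1 := by
  classical
  have hEfin := M.ground_finite
  set 𝒬 := {X : Set α | X ⊆ M.E ∧ X.ncard = 3 ∧ M.eRk X ≤ 1} with h𝒬
  rcases 𝒬.eq_empty_or_nonempty with hemp | ⟨X₀, hX₀⟩
  · rw [hemp]; simp
  obtain ⟨hX₀E, hX₀3, hX₀r⟩ := hX₀
  have hX₀fin : X₀.Finite := hEfin.subset hX₀E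
  obtain ⟨x, hxX₀⟩ : X₀.Nonempty := by rw [← Set.ncard_pos hX₀fin, hX₀3]; norm_num
  have hxE : x ∈ M.E := hX₀E hxX₀
  set F := M.closure {x} with hFdef
  have hF : F ⊆ M.E := M.closure_subset_ground _
  have hFfin : F.Finite := hEfin.subset hF
  have hF4 : F.ncard ≤ 4 := ncard_closure_singleton_le_four M hK hd (by omega) x
  have hX₀F : X₀ ⊆ F := subset_closure_singleton_of_eRk_le_one M hL hX₀E hX₀r hxX₀
  have hFr : M.eRk F ≤ 1 := eRk_le_one_of_subset_closure_singleton M (subset_refl _)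
  have hsub : 𝒬 ⊆ {X : Set α | X ⊆ F ∧ X.ncard = 3} := by
    intro X hX
    obtain ⟨hXE, hX3, hXr⟩ := hX
    refine ⟨?_, hX3⟩
    rcases (X ∩ F).eq_empty_or_nonempty with hemp | ⟨x', hx'X, hx'F⟩
    · exfalso
      have hXfin : X.Finite := hEfin.subset hXE
      have hdisj : Disjoint X₀ X := by
        rw [Set.disjoint_left]
        intro w hw hwX
        have : w ∈ X ∩ F := ⟨hwX, hX₀F hw⟩
        rw [hemp] at this
        exact this
      have hcard : (X₀ ∪ X).ncard = 6 := by
        rw [Set.ncard_union_eq hdisj hX₀fin hXfin]; omega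
      have hU : X₀ ∪ X ⊆ M.E := union_subset hX₀E hXE
      have hr : M.eRk (X₀ ∪ X) ≤ 2 := by
        calc M.eRk (X₀ ∪ X) ≤ M.eRk X₀ + M.eRk X := M.eRk_union_le_eRk_add_eRk X₀ X
          _ ≤ 1 + 1 := add_le_add hX₀r hXr
          _ = 2 := by norm_num
      have hr' := eRk_toNat_le_of_eRk_le M hU (m := 2) (by exact_mod_cast hr)
      have := ncard_le_eRk_toNat_add_three M hK hd hU (by omega)
      omega
    · have hx'E : x' ∈ M.E := hXE hx'X
      have h1 : X ⊆ M.closure {x'} := subset_closure_singleton_of_eRk_le_one M hL hXE hXr hx'X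
      have h2 : M.closure {x'} = F :=
        closure_singleton_eq_of_mem_closure_singleton M hxE (hL x hxE) hx'F (hL x' hx'E)
      rw [← h2]; exact h1
  -- `|F| ≤ 3`: a class of `4` carries `6` dependent pairs
  have hF3 : F.ncard ≤ 3 := by
    by_contra h
    push Not at h
    have hpairs : {P : Set α | P ⊆ F ∧ P.ncard = 2} ⊆ {P : Set α | P ⊆ M.E ∧ P.ncard = 2 ∧ M.Dep P} := by
      intro P hP
      obtain ⟨hPF, hP2⟩ := hP
      refine ⟨hPF.trans hF, hP2, ?_⟩
      have hPfin : P.Finite := hFfin.subset hPF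
      rw [← Matroid.eRk_lt_encard_iff_dep_of_finite hPfin (hPF.trans hF), ← hPfin.cast_ncard_eq, hP2]
      exact lt_of_le_of_lt ((M.eRk_mono hPF).trans hFr) (by norm_num)
    have h6 : 6 ≤ {P : Set α | P ⊆ F ∧ P.ncard = 2}.ncard := by
      rw [ncard_subsets_eq_choose hFfin 2]
      have : F.ncard = 4 := by omega
      rw [this]; decide
    have := Set.ncard_le_ncard hpairs (hEfin.finite_subsets.subset (fun P hP => hP.1))
    omega
  calc 𝒬.ncard ≤ {X : Set α | X ⊆ F ∧ X.ncard = 3}.ncard :=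
        Set.ncard_le_ncard hsub (hFfin.finite_subsets.subset (fun X hX => hX.1))
    _ = F.ncard.choose 3 := ncard_subsets_eq_choose hFfin 3
    _ ≤ (3 : ℕ).choose 3 := Nat.choose_le_choose 3 hF3
    _ = 1 := by decide

/-- A `4`-set `X ⊇ P` of rank `≤ 2` with no rank-`1` triple and `X ∖ P` independent yields a triangle through a point of
`P`: with `≥ 4` dependent pairs there is none (LEMMA K, `n ≥ 11`). -/
theorem ncard_four_eRk_le_two_through_pair_eq_zero_of_four_le (M : Matroid α) [M.Finite]
    (hL : ∀ e ∈ M.E, ¬ M.IsLoop e) (hK : ∀ e, ¬ M.IsColoop e) (hd : M.E.encard = M.eRank + ((4 : ℕ) : ℕ∞))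
    (hn : 11 ≤ M.E.ncard) (h4 : 4 ≤ {P : Set α | P ⊆ M.E ∧ P.ncard = 2 ∧ M.Dep P}.ncard) {P : Set α}
    (hPE : P ⊆ M.E) (hP2 : P.ncard = 2) (hPdep : M.Dep P) :
    {X : Set α | X ⊆ M.E ∧ X.ncard = 4 ∧ P ⊆ X ∧ M.eRk X ≤ 2 ∧
      (∀ Z ⊆ X, Z.ncard = 3 → ¬ M.eRk Z ≤ 1) ∧ ¬ M.Dep (X \ P)}.ncard ≤ 0 := by
  classical
  have hEfin := M.ground_finite
  obtain ⟨p, p', hpp', rfl⟩ := Set.ncard_eq_two.1 hP2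
  have hpE : p ∈ M.E := hPE (by simp)
  have hLp := hL p hpE
  have hp'cl : p' ∈ M.closure {p} := mem_closure_singleton_of_dep_pair M hpE hLp hPdep
  have hpcl : p ∈ M.closure {p} := M.mem_closure_self p hpE
  have hpind : M.Indep {p} := indep_singleton_of_not_isLoop M hpE hLp
  rw [Nat.le_zero, Set.ncard_eq_zero (hEfin.finite_subsets.subset (fun X hX => hX.1)),
    Set.eq_empty_iff_forall_notMem]
  rintro X ⟨hXE, hX4, hPX, hXr, hno1, hXP⟩
  have hXfin : X.Finite := hEfin.subset hXE
  have hQ2 : (X \ {p, p'}).ncard = 2 := by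
    have := Set.ncard_sdiff_add_ncard_of_subset hPX hXfin
    rw [Set.ncard_pair hpp'] at this
    omega
  -- the points of `X ∖ P` are outside `cl {p}`
  have hQcl : ∀ w ∈ X \ {p, p'}, w ∉ M.closure {p} := by
    intro w hw hwcl
    apply hno1 (insert w {p, p'}) (Set.insert_subset hw.1 hPX)
    · rw [Set.ncard_insert_of_notMem hw.2, Set.ncard_pair hpp']
    · exact eRk_le_one_of_subset_closure_singleton M (x := p) (by
        intro z hz
        simp only [Set.mem_insert_iff, Set.mem_singleton_iff] at hz
        rcases hz with rfl | rfl | rfl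
        · exact hwcl
        · exact hpcl
        · exact hp'cl)
  -- `{p} ∪ (X ∖ P)` is a triangle
  set T := insert p (X \ {p, p'}) with hTdef
  have hpT : p ∉ X \ {p, p'} := fun h => h.2 (by simp)
  have hTX : T ⊆ X := Set.insert_subset (hPX (by simp)) sdiff_subset
  have hTE : T ⊆ M.E := hTX.trans hXE
  have hT3 : T.ncard = 3 := by rw [hTdef, Set.ncard_insert_of_notMem hpT (hXfin.subset sdiff_subset), hQ2]
  have hTdep : M.Dep T := by
    have hfin : T.Finite := hXfin.subset hTX
    rw [← Matroid.eRk_lt_encard_iff_dep_of_finite hfin hTE, ← hfin.cast_ncard_eq, hT3]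
    exact lt_of_le_of_lt (M.eRk_mono hTX) (lt_of_le_of_lt hXr (by norm_num))
  have hTc : M.IsCircuit T := by
    apply isCircuit_of_dep_three_of_no_dep_pair M hTE hT3 hTdep
    intro Q hQT hQ2' hQdep
    -- `Q` is a pair inside `T`: it is `X ∖ P` (independent) or contains `p` with a point outside `cl {p}`
    by_cases hpQ : p ∈ Q
    · obtain ⟨a, b, hab, rfl⟩ := Set.ncard_eq_two.1 hQ2'
      have hmem : ∀ w ∈ ({a, b} : Set α), w ≠ p → w ∈ X \ {p, p'} := by
        intro w hw hwp
        rcases hQT hw with h | h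
        · exact absurd h hwp
        · exact h
      have hpab : p = a ∨ p = b := by simpa using hpQ
      rcases hpab with hpa | hpb
      · have hbQ : b ∈ X \ {p, p'} := hmem b (by simp) (by rw [hpa]; exact Ne.symm hab)
        have hQeq : ({a, b} : Set α) = {p, b} := by rw [hpa]
        rw [hQeq] at hQdep
        exact hQcl b hbQ (mem_closure_singleton_of_dep_pair M hpE hLp hQdep)
      · have haQ : a ∈ X \ {p, p'} := hmem a (by simp) (by rw [hpb]; exact hab)
        have hQeq : ({a, b} : Set α) = {p, a} := by rw [hpb, Set.pair_comm]
        rw [hQeq] at hQdep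
        exact hQcl a haQ (mem_closure_singleton_of_dep_pair M hpE hLp hQdep)
    · have hQsub : Q ⊆ X \ {p, p'} := by
        intro w hw
        rcases hQT hw with h | h
        · exact absurd h (by rintro rfl; exact hpQ hw)
        · exact h
      have hQeq : Q = X \ {p, p'} := Set.eq_of_subset_of_ncard_le hQsub (by omega) (hXfin.subset sdiff_subset)
      rw [hQeq] at hQdep
      exact hXP hQdep
  exact not_isCircuit_of_four_le_ncard_dep_pairs M hL hK hd hn h4 hTc (by omega) (by omega)

/-- **`D₂ ≥ 4 ⇒ Q₄² ≤ 5 + (n − 3) · Q₃¹ + D₂ · D₂`** (`n ≥ 11`; no triangles). -/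
theorem ncard_four_eRk_le_two_le_split_of_four_le (M : Matroid α) [M.Finite] (hL : ∀ e ∈ M.E, ¬ M.IsLoop e)
    (hK : ∀ e, ¬ M.IsColoop e) (hd : M.E.encard = M.eRank + ((4 : ℕ) : ℕ∞)) (hn : 11 ≤ M.E.ncard)
    (h4 : 4 ≤ {P : Set α | P ⊆ M.E ∧ P.ncard = 2 ∧ M.Dep P}.ncard) :
    {X : Set α | X ⊆ M.E ∧ X.ncard = 4 ∧ M.eRk X ≤ 2}.ncard ≤
      5 + (M.E.ncard - 3) * {Z : Set α | Z ⊆ M.E ∧ Z.ncard = 3 ∧ M.eRk Z ≤ 1}.ncard +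
        {P : Set α | P ⊆ M.E ∧ P.ncard = 2 ∧ M.Dep P}.ncard * {P : Set α | P ⊆ M.E ∧ P.ncard = 2 ∧ M.Dep P}.ncard := by
  have := ncard_four_eRk_le_two_le_split_of M hL hK hd (by omega) 0
    (fun _ hPE hP2 hPdep => ncard_four_eRk_le_two_through_pair_eq_zero_of_four_le M hL hK hd hn h4 hPE hP2 hPdep)
  simpa using this

/-- **`D₂ ≥ 5 ⇒ Q₄² ≤ 4 · (n − 4) + 1`** (`n ≥ 11`): every `4`-set of rank `≤ 2` meets the class of `4` in at least
three points. -/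
theorem ncard_four_eRk_le_two_le_of_five_le (M : Matroid α) [M.Finite] (hL : ∀ e ∈ M.E, ¬ M.IsLoop e)
    (hK : ∀ e, ¬ M.IsColoop e) (hd : M.E.encard = M.eRank + ((4 : ℕ) : ℕ∞)) (hn : 11 ≤ M.E.ncard)
    (h5 : 5 ≤ {P : Set α | P ⊆ M.E ∧ P.ncard = 2 ∧ M.Dep P}.ncard) :
    {X : Set α | X ⊆ M.E ∧ X.ncard = 4 ∧ M.eRk X ≤ 2}.ncard ≤ 4 * (M.E.ncard - 4) + 1 := by
  classical
  have hEfin := M.ground_finite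
  obtain ⟨P₀, hP₀⟩ : {P : Set α | P ⊆ M.E ∧ P.ncard = 2 ∧ M.Dep P}.Nonempty := by
    rw [← Set.ncard_pos (hEfin.finite_subsets.subset (fun P hP => hP.1))]; omega
  obtain ⟨hP₀E, hP₀2, hP₀dep⟩ := hP₀
  obtain ⟨x, y, hxy, rfl⟩ := Set.ncard_eq_two.1 hP₀2
  have hxE : x ∈ M.E := hP₀E (by simp)
  have hyE : y ∈ M.E := hP₀E (by simp)
  obtain ⟨hF4, hall⟩ := closure_singleton_of_five_dep_pairs M hL hK hd (by omega) h5 hxy hxE hyE hP₀dep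
  set F := M.closure {x} with hFdef
  have hF : F ⊆ M.E := M.closure_subset_ground _
  have hEF : (M.E \ F).ncard = M.E.ncard - 4 := by
    have := Set.ncard_sdiff_add_ncard_of_subset hF hEfin
    omega
  have hsub : {X : Set α | X ⊆ M.E ∧ X.ncard = 4 ∧ M.eRk X ≤ 2} ⊆
      {X : Set α | X ⊆ M.E ∧ X.ncard = 4 ∧ (X ∩ F).ncard = 3} ∪
        {X : Set α | X ⊆ M.E ∧ X.ncard = 4 ∧ (X ∩ F).ncard = 4} := by
    intro X hX
    obtain ⟨hXE, hX4, hXr⟩ := hX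
    have hXfin : X.Finite := hEfin.subset hXE
    -- every dependent 3-subset of `X` contains a dependent pair (no triangles)
    have hno3 : ∀ T ⊆ X, T.ncard = 3 → ∃ P ⊆ T, P.ncard = 2 ∧ M.Dep P := by
      intro T hTX hT3
      by_contra hno
      push Not at hno
      have hTdep : M.Dep T := by
        have hfin : T.Finite := hXfin.subset hTX
        rw [← Matroid.eRk_lt_encard_iff_dep_of_finite hfin (hTX.trans hXE), ← hfin.cast_ncard_eq, hT3]
        exact lt_of_le_of_lt (M.eRk_mono hTX) (lt_of_le_of_lt hXr (by norm_num))
      have hc := isCircuit_of_dep_three_of_no_dep_pair M (hTX.trans hXE) hT3 hTdep hno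
      exact not_isCircuit_of_four_le_ncard_dep_pairs M hL hK hd hn (by omega) hc (by omega) (by omega)
    -- a dependent pair `P ⊆ X`, inside `F`
    obtain ⟨e, he⟩ : X.Nonempty := by rw [← Set.ncard_pos hXfin, hX4]; norm_num
    obtain ⟨P, hPT, hP2, hPdep⟩ := hno3 (X \ {e}) sdiff_subset (by rw [Set.ncard_sdiff_singleton_of_mem he, hX4])
    have hPX : P ⊆ X := hPT.trans sdiff_subset
    have hPF : P ⊆ F := hall P (hPX.trans hXE) hP2 hPdep
    obtain ⟨p, p', hpp', rfl⟩ := Set.ncard_eq_two.1 hP2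
    have hpE : p ∈ M.E := hXE (hPX (by simp))
    have hpF : p ∈ F := hPF (by simp)
    -- a third point of `X` in `F`
    have h3 : 3 ≤ (X ∩ F).ncard := by
      by_contra hlt
      push Not at hlt
      -- then `X ∖ P` is outside `F` and `{p} ∪ (X ∖ P)` is a triangle
      have hXP2 : (X \ {p, p'}).ncard = 2 := by
        have := Set.ncard_sdiff_add_ncard_of_subset hPX hXfin
        rw [Set.ncard_pair hpp'] at this
        omega
      have hout : ∀ w ∈ X \ {p, p'}, w ∉ F := by
        intro w hw hwF
        apply absurd hlt
        push Not
        have : insert w {p, p'} ⊆ X ∩ F := by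
          intro z hz
          rcases hz with rfl | hz
          · exact ⟨hw.1, hwF⟩
          · exact ⟨hPX hz, hPF hz⟩
        have h3' : (insert w {p, p'} : Set α).ncard = 3 := by
          rw [Set.ncard_insert_of_notMem hw.2, Set.ncard_pair hpp']
        rw [← h3']
        exact Set.ncard_le_ncard this (hXfin.subset inter_subset_left)
      set T := insert p (X \ {p, p'}) with hTdef
      have hTX : T ⊆ X := Set.insert_subset (hPX (by simp)) sdiff_subset
      have hpT : p ∉ X \ {p, p'} := fun h => h.2 (by simp)
      have hT3 : T.ncard = 3 := by rw [hTdef, Set.ncard_insert_of_notMem hpT (hXfin.subset sdiff_subset), hXP2]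
      obtain ⟨Q, hQT, hQ2, hQdep⟩ := hno3 T hTX hT3
      have hQF : Q ⊆ F := hall Q ((hQT.trans hTX).trans hXE) hQ2 hQdep
      -- `Q` has a point of `X ∖ P` (it is not `{p}` alone), which lies outside `F`
      obtain ⟨a, b, hab, rfl⟩ := Set.ncard_eq_two.1 hQ2
      have hone : ∃ w ∈ ({a, b} : Set α), w ∈ X \ {p, p'} := by
        by_contra hcon
        push Not at hcon
        have ha : a = p := by
          rcases hQT (by simp : a ∈ ({a, b} : Set α)) with h | h
          · exact h
          · exact absurd h (hcon a (by simp))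
        have hb : b = p := by
          rcases hQT (by simp : b ∈ ({a, b} : Set α)) with h | h
          · exact h
          · exact absurd h (hcon b (by simp))
        exact hab (ha.trans hb.symm)
      obtain ⟨w, hwQ, hw⟩ := hone
      exact hout w hw (hQF hwQ)
    have h4 : (X ∩ F).ncard ≤ 4 := by
      rw [← hX4]; exact Set.ncard_le_ncard inter_subset_left hXfin
    rcases Nat.lt_or_ge (X ∩ F).ncard 4 with hlt | hge
    · exact Or.inl ⟨hXE, hX4, by omega⟩
    · exact Or.inr ⟨hXE, hX4, by omega⟩
  have hc3 := ncard_inter_eq_le hEfin hF 4 3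
  have hc4 := ncard_inter_eq_le hEfin hF 4 4
  rw [hF4, hEF] at hc3 hc4
  rw [show (4 : ℕ) - 3 = 1 by norm_num, show (4 : ℕ).choose 3 = 4 by decide, Nat.choose_one_right] at hc3
  rw [show (4 : ℕ) - 4 = 0 by norm_num, show (4 : ℕ).choose 4 = 1 by decide, Nat.choose_zero_right] at hc4
  have hfin : ∀ i, {X : Set α | X ⊆ M.E ∧ X.ncard = 4 ∧ (X ∩ F).ncard = i}.Finite :=
    fun _ => hEfin.finite_subsets.subset (fun X hX => hX.1)
  calc {X : Set α | X ⊆ M.E ∧ X.ncard = 4 ∧ M.eRk X ≤ 2}.ncard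
      ≤ ({X : Set α | X ⊆ M.E ∧ X.ncard = 4 ∧ (X ∩ F).ncard = 3} ∪
          {X : Set α | X ⊆ M.E ∧ X.ncard = 4 ∧ (X ∩ F).ncard = 4}).ncard :=
        Set.ncard_le_ncard hsub ((hfin 3).union (hfin 4))
    _ ≤ {X : Set α | X ⊆ M.E ∧ X.ncard = 4 ∧ (X ∩ F).ncard = 3}.ncard +
          {X : Set α | X ⊆ M.E ∧ X.ncard = 4 ∧ (X ∩ F).ncard = 4}.ncard := Set.ncard_union_le _ _
    _ ≤ 4 * (M.E.ncard - 4) + 1 * 1 := by gcongr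
    _ = 4 * (M.E.ncard - 4) + 1 := by ring

/-- **`Q₄² ≤ max (n + 29) (4n − 15)`** (`n ≥ 11`) — the cap of the ν = 4 program on every `n`; `41` at `n = 12`. -/
theorem ncard_four_eRk_le_two_le (M : Matroid α) [M.Finite] (hL : ∀ e ∈ M.E, ¬ M.IsLoop e)
    (hK : ∀ e, ¬ M.IsColoop e) (hd : M.E.encard = M.eRank + ((4 : ℕ) : ℕ∞)) (hn : 11 ≤ M.E.ncard) :
    {X : Set α | X ⊆ M.E ∧ X.ncard = 4 ∧ M.eRk X ≤ 2}.ncard ≤ max (M.E.ncard + 29) (4 * M.E.ncard - 15) := by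
  have hm1 : M.E.ncard + 29 ≤ max (M.E.ncard + 29) (4 * M.E.ncard - 15) := le_max_left _ _
  have hm2 : 4 * M.E.ncard - 15 ≤ max (M.E.ncard + 29) (4 * M.E.ncard - 15) := le_max_right _ _
  rcases Nat.lt_or_ge {P : Set α | P ⊆ M.E ∧ P.ncard = 2 ∧ M.Dep P}.ncard 4 with hlt | hge
  · have hs := ncard_four_eRk_le_two_le_split M hL hK hd (by omega)
    have hq := ncard_three_eRk_le_one_le_one_of_le_five M hL hK hd (by omega) (by omega)
    have hd3 : {P : Set α | P ⊆ M.E ∧ P.ncard = 2 ∧ M.Dep P}.ncard ≤ 3 := by omega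
    have hsq : {P : Set α | P ⊆ M.E ∧ P.ncard = 2 ∧ M.Dep P}.ncard *
        {P : Set α | P ⊆ M.E ∧ P.ncard = 2 ∧ M.Dep P}.ncard ≤ 3 * 3 :=
      Nat.mul_le_mul hd3 hd3
    have hq' : (M.E.ncard - 3) * {Z : Set α | Z ⊆ M.E ∧ Z.ncard = 3 ∧ M.eRk Z ≤ 1}.ncard ≤
        (M.E.ncard - 3) * 1 := Nat.mul_le_mul_left _ hq
    omega
  rcases Nat.lt_or_ge {P : Set α | P ⊆ M.E ∧ P.ncard = 2 ∧ M.Dep P}.ncard 5 with hlt' | hge'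
  · have hs := ncard_four_eRk_le_two_le_split_of_four_le M hL hK hd hn hge
    have hq := ncard_three_eRk_le_one_le_one_of_le_five M hL hK hd (by omega) (by omega)
    have h4 : {P : Set α | P ⊆ M.E ∧ P.ncard = 2 ∧ M.Dep P}.ncard = 4 := by omega
    have hq' : (M.E.ncard - 3) * {Z : Set α | Z ⊆ M.E ∧ Z.ncard = 3 ∧ M.eRk Z ≤ 1}.ncard ≤
        (M.E.ncard - 3) * 1 := Nat.mul_le_mul_left _ hq
    rw [h4] at hs
    omega
  · have := ncard_four_eRk_le_two_le_of_five_le M hL hK hd hn hge'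
    omega

end S1CFG

end PercRepro
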